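import Summits.CriticalPhenomena.PercolationContinuityZ3.Theorems.Transplant.SkelPhiFaceRouteInputs3X
import Summits.CriticalPhenomena.PercolationContinuityZ3.Theorems.Transplant.SkelNegBParamsFoot
import Summits.CriticalPhenomena.PercolationContinuityZ3.Theorems.Transplant.SkelPhiFaceRouteReadings
import Summits.CriticalPhenomena.PercolationContinuityZ3.Theorems.Transplant.SkelPhiNegReachRoomsRun
import Summits.CriticalPhenomena.PercolationContinuityZ3.Theorems.Transplant.SkelPhiRootNumbersY
import HarnessLib

/-!
# N1 ({±1} node), (F) inner route under RULING B.15, part R4b v6 (hp-8 g35): **`faceRoute_of_numbers6_x`** = v5 with (L-F2) (lane INBOX 2026-08-21T23:58Z / 2026-08-22T01:15Z, adopted from the root residue's v6 `rootOblTWAt_of_numbers6_x`): the near-`c` footprints of the bridge region and of the hop prism are read by the two LATTICE FUNCTIONALS `Λ₀ = |vβΔ₀ − vαΔ₁|`, `Λ₁ = |nΔ₁ − hΔ₀|` (`hΛR` over the bridge region, `lam_bounds_of_mem_pgramCyl` over the prism, `hnear` in Λ-form) instead of the per-axis extents `(sα, sβ)` (whose fine reading imports the long box's aspect `ℓ_L/n_L`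 — stmt-g15 FEASIBILITY §B.18), and (L-F5): the two bands' seed clearances are HYPOTHESES in the served form `… → w ∉ S` (discharged per region upstream, by an α-reading or a level reading), passed to `faceRoute_of_inputs3_x` (over `faceRoute_of_bridge₄`); v5: target test as a two-sided CELL BOX `FS_c w ∈ Icc LLO LHI` (the contact is transversally off-centre by ≫ b₀, a footprint window centred at the contact cannot hold the arrival box) + PER-REGION readings of both runs (a drifting y′-run must be read region by region: its prism hull over-reads axis-0 cells by ≈ N·|v_α|/n strides) — over `faceRoute_of_inputs2_x` (orientation-aware kit tables `pexRO/pexXO/pexYO`, G2) — `faceRoute_of_numbers_x` with ANISOTROPIC near-`c` extents `(sα, sβ)` (stmt-g14 18:19:31Z: the single extent is not dischargeable on axis 0 when ℓ_L ≫ n_L; the reading `hnear` is a hypothesis served by `abs_fineSkel_le_of_near₂`, p298056) — `faceRoute_of_inputs_x` (p297428) with every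
# ROOM discharged, following p3-g9's `rootOblTWAt_of_numbers_x/_y` AT THE BASE `c` (the kit centre): footprint tests `FootBox … (fineSkel φ c … ·)`
# converted to the habitat / small arrival box by the hypotheses `hPlfoot`/`hMfoot` (`SkelPhiFaceRouteReadings`); along origin `c_L` (`φ c_L = φ c + y_L`),
# tangential origin `c_T` (`φ c_T = φ c + y_T`); hop landing box; near-`c` footprints; x-run regions via `runX_sign_mem_Icc`, y′-run regions / last core
# via `runY_sign_mem_Icc`; cross links bridge → x-run, x-run → y′-run (`runY_core_zero_of_runX_core`); nonempty targets; clearances.  What remains: served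
# inputs, hop, seed facts, the two conversions, kit blocks, counts, excess radius, INTEGER INEQUALITIES.
builds on p205010 (kernel theorem, internal audit signed; external expert review pending) — nothing in this file uses p205010; no claim about the open node.
Lane `prim-bschramm`, seat `prim-hp-8` (gen 35); helper file (`--supports stmt-CriticalPhenomena-4575 --as helper`).
[cite: KozmaNitzan2024, §4 Lemma 10 (pp. 17–21), Lemma 11 (pp. 22–23), Lemma 12 (pp. 23–25), p. 30 (Step III)] [cite: MartineauTassion2017, §3.2, §4.3 Lemma 4.2]
-/

noncomputable section

open MeasureTheory ProbabilityTheory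
open scoped ENNReal Classical

namespace Summit.CriticalPhenomena.PercolationContinuityZ3.Theorems.Transplant

namespace Skelφ

open Literature.Probability.Percolation Literature.Probability.LatticeModels SimpleGraph GadgetSystem Contour KNCells
open Literature.Probability.Percolation.KozmaNitzan.Cells (oth sgOf stepVec_apply_fst)
open KNLevels ChainPlanar ChainPara
open Literature.Barriers.CriticalPhenomena (graphBall mem_graphBall_self graphBall_mono)
open BoxProdZ2 (ConcRadiiG)
open Skel (winGraph routeW excess)
open SkelI (tanOff)
open TwoAxis.Para (modulus)

variable {V : Type} [DecidableEq V] {G : SimpleGraph V} [G.LocallyFinite] {φ ψc : V → Site 2}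

/-- **THE ROUTE DATUM OF A FACE-STEP KIT AT AN x-FACE FROM THE INPUTS AND NUMBERS** (see the module docstring; one planar map `φ` for kit, bridge
and runs). [cite: KozmaNitzan2024, §4 Lemma 10 (pp. 17–21), Lemma 11 (pp. 22–23), Lemma 12 (pp. 23–25)] -/
theorem faceRoute_of_numbers6_x [Countable V] {types : Finset V} (hlipφ : Lip G φ) (hstep : Steps G φ) (hfr : Frames G φ types) (hκ : CylConn G φ types)
    {Δg : ℕ} (hΔg : ∀ v, G.degree v ≤ Δg)
    {w₀ c : V} {Rπ L : ℕ} {Wt : Sym2 V → unitInterval} {q : unitInterval} {D T Z : Finset V}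
    (hWG : ∀ e, e ∉ G.edgeSet → Wt e = 0) (hWD : IsSubbox (winGraph G w₀ Rπ) Wt q D) (hDπ : ∀ u ∈ D, u ∈ graphBall G w₀ Rπ)
    (hcL : c ∈ graphBall G w₀ (Rπ - L)) (hLπ : L ≤ Rπ)
    {Pl : Finset (Site 2)} {MM : Finset V} (hPlD : Win G ψc w₀ Pl Rπ ⊆ D) (hMT : MM ⊆ T) (hMZ : Disjoint MM Z) (du : MDir) {σ : ℤ} (hσ : σ = 1 ∨ σ = -1)
    {Af vα vβ c0f c1f Df : ℤ} (hAf : 0 ≤ Af) {nL : ℕ} (hnL : 1 ≤ nL) (hL : ℤ) (hmf : 0 ≤ modulus nL hL vα vβ) (hc0 : 0 ≤ c0f) (hc1 : 0 ≤ c1f)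
    (hDf : 0 < Df) {flo fhi fw : ℤ} {LLO LHI : Site 2}
    (hPlfoot : ∀ w ∈ graphBall G c L, FootBox flo fhi fw du (fineSkel φ c Af nL hL vα vβ c0f c1f (Df / 2) (Df / 2) Df w) → ψc w ∈ Pl)
    (hMfoot : ∀ w ∈ graphBall G c L, fineSkel φ c Af nL hL vα vβ c0f c1f (Df / 2) (Df / 2) Df w ∈ Finset.Icc LLO LHI → w ∈ MM)
    {S : Finset V} (hcS : c ∈ S) (hSconn : ∀ s ∈ S, PathIn G (↑S : Set V) c s) (hSD : S ⊆ D) {ρ : ℕ} (hSρ : ∀ s ∈ S, s ∈ graphBall G c ρ)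
    (hρL : ρ ≤ L) {kb : ℕ} (hSφ : ∀ s ∈ S, |φ s 0 - φ c 0| ≤ kb)
    (B : BridgePrm) (hB : BridgeOK B) {kq : ℕ} (hκL : hL.natAbs ≤ kq * nL) (ℓ' R's qB Nr Rl : ℕ) {σT vL : ℤ} (hσT : σT = 1 ∨ σT = -1)
    (hvL : |vL| ≤ nL) (hlay : (nL + hL.natAbs : ℕ) ≤ (nL : ℤ) * ℓ' + 1) (R'₃ qB₃ N₃ : ℕ)
    {yL yT : Site 2} (cL cT : V) (hcLφ : φ cL = φ c + yL) (hcTφ : φ cT = φ c + yT) {RcL RcT : ℕ} (hcLπ : cL ∈ graphBall G c RcL)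
    (hcTπ : cT ∈ graphBall G c RcT)
    (Rlev₁ N₁ j₀₁ j₁₁ Rlev₂ N₂ j₀₂ j₁₂ Rlev₃ N₃' j₀₃ j₁₃ : ℕ) (hRl₁ : Rlev₁ + 1 ≤ B.R') (hRl₂ : Rlev₂ + 1 ≤ R's) (hRl₃ : Rlev₃ + 1 ≤ R'₃)
    (hj₁ : j₁₁ ≤ Rlev₁) (hj₂ : j₁₂ ≤ Rlev₂) (hj₃ : j₁₃ ≤ Rlev₃)
    (hB0 : Finset.Icc (pt nL (σ * hL)) (pt nL (σ * hL + ℓ')) ⊆ Finset.Icc B.B₀lo B.B₀hi) (hRlL : Rl ≤ L)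
    -- near-`c` footprints READ BY THE TWO LATTICE FUNCTIONALS `Λ₀ = |vβΔ₀ − vαΔ₁|`, `Λ₁ = |nΔ₁ − hΔ₀|` (L-F2): the bridge region, the hop prism
    {Λ₀ Λ₁ : ℤ} (hΛR : ∀ x ∈ Finset.Icc B.regionLo B.regionHi, |vβ * (σ * x 0) - vα * x 1| ≤ Λ₀ ∧ |(nL : ℤ) * x 1 - hL * (σ * x 0)| ≤ Λ₁)
    (hvα : |vα| ≤ nL) (hΛQ0 : modulus nL hL vα vβ + (nL : ℤ) * ((3 * ℓ' : ℕ) : ℤ) ≤ Λ₀) (hΛQ1 : (nL : ℤ) * ((3 * ℓ' : ℕ) : ℤ) ≤ Λ₁)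
    (hnear : ∀ w, |vβ * (φ w 0 - φ c 0) - vα * (φ w 1 - φ c 1)| ≤ Λ₀ → |(nL : ℤ) * (φ w 1 - φ c 1) - hL * (φ w 0 - φ c 0)| ≤ Λ₁ →
      FootBox flo fhi fw du (fineSkel φ c Af nL hL vα vβ c0f c1f (Df / 2) (Df / 2) Df w))
    {paLo pbLo paHi pbHi : ℕ → ℤ}
    (hreg : ∀ k ≤ Nr, (xRunSched nL ℓ' hL R's qB Nr).region k ⊆ Finset.Icc (pt (paLo k) (pbLo k)) (pt (paHi k) (pbHi k)))
    {PLO PHI : ℕ → Site 2}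
    (hP0 : ∀ k ≤ Nr, PLO k 0 ≤ TwoAxis.Para.coarse c0f (Df / 2) Df (TwoAxis.Para.lam0 Af vα vβ yL) +
      (c0f * (Af * (modulus nL hL vα vβ * (min (σ * paLo k) (σ * paHi k)) -
        max (vα * ((shearUnit nL hL : ℤ) * (min (σ * pbLo k) (σ * pbHi k) - 1))) (vα * ((shearUnit nL hL : ℤ) * (max (σ * pbLo k) (σ * pbHi k)) + shearUnit nL hL - 1))) / nL)) / Df)
    (hP1 : ∀ k ≤ Nr, TwoAxis.Para.coarse c0f (Df / 2) Df (TwoAxis.Para.lam0 Af vα vβ yL) +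
      (c0f * (Af * (modulus nL hL vα vβ * (max (σ * paLo k) (σ * paHi k)) -
        min (vα * ((shearUnit nL hL : ℤ) * (min (σ * pbLo k) (σ * pbHi k) - 1))) (vα * ((shearUnit nL hL : ℤ) * (max (σ * pbLo k) (σ * pbHi k)) + shearUnit nL hL - 1))) / nL)) / Df
        + 1 ≤ PHI k 0)
    (hP2 : ∀ k ≤ Nr, PLO k 1 ≤ TwoAxis.Para.coarse c1f (Df / 2) Df (TwoAxis.Para.lam1 Af nL hL yL) + (c1f * (Af * ((shearUnit nL hL : ℤ) * (min (σ * pbLo k) (σ * pbHi k) - 1)))) / Df)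
    (hP3 : ∀ k ≤ Nr, TwoAxis.Para.coarse c1f (Df / 2) Df (TwoAxis.Para.lam1 Af nL hL yL) +
      (c1f * (Af * ((shearUnit nL hL : ℤ) * (max (σ * pbLo k) (σ * pbHi k)) + shearUnit nL hL - 1))) / Df + 1 ≤ PHI k 1)
    (hPf₁ : ∀ k ≤ Nr, sgOf du = 1 → flo ≤ PLO k du.1 ∧ PHI k du.1 ≤ fhi) (hPf₂ : ∀ k ≤ Nr, sgOf du = -1 → flo ≤ -PHI k du.1 ∧ -PLO k du.1 ≤ fhi)
    (hPf₃ : ∀ k ≤ Nr, -fw ≤ PLO k (oth du.1) ∧ PHI k (oth du.1) ≤ fw)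
    {yaLo ybLo yaHi ybHi : ℕ → ℤ} {laLo lbLo laHi lbHi : ℤ}
    (hregY : ∀ k ≤ N₃, (yRunSched hnL hvL hlay R'₃ qB₃ N₃).region k ⊆ Finset.Icc (pt (yaLo k) (ybLo k)) (pt (yaHi k) (ybHi k)))
    (hlastc : (yRunSched hnL hvL hlay R'₃ qB₃ N₃).core (N₃ + 1) ⊆ Finset.Icc (pt laLo lbLo) (pt laHi lbHi))
    {YLO YHI : ℕ → Site 2}
    (hY0 : ∀ k ≤ N₃, YLO k 0 ≤ TwoAxis.Para.coarse c0f (Df / 2) Df (TwoAxis.Para.lam0 Af vα vβ yT) +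
      (c0f * (Af * (modulus nL hL vα vβ * (min (σT * ybLo k) (σT * ybHi k)) -
        max (vα * ((shearUnit nL hL : ℤ) * (min (σT * yaLo k) (σT * yaHi k) - 1))) (vα * ((shearUnit nL hL : ℤ) * (max (σT * yaLo k) (σT * yaHi k)) + shearUnit nL hL - 1))) / nL)) / Df)
    (hY1 : ∀ k ≤ N₃, TwoAxis.Para.coarse c0f (Df / 2) Df (TwoAxis.Para.lam0 Af vα vβ yT) +
      (c0f * (Af * (modulus nL hL vα vβ * (max (σT * ybLo k) (σT * ybHi k)) -
        min (vα * ((shearUnit nL hL : ℤ) * (min (σT * yaLo k) (σT * yaHi k) - 1))) (vα * ((shearUnit nL hL : ℤ) * (max (σT * yaLo k) (σT * yaHi k)) + shearUnit nL hL - 1))) / nL)) / Df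
        + 1 ≤ YHI k 0)
    (hY2 : ∀ k ≤ N₃, YLO k 1 ≤ TwoAxis.Para.coarse c1f (Df / 2) Df (TwoAxis.Para.lam1 Af nL hL yT) + (c1f * (Af * ((shearUnit nL hL : ℤ) * (min (σT * yaLo k) (σT * yaHi k) - 1)))) / Df)
    (hY3 : ∀ k ≤ N₃, TwoAxis.Para.coarse c1f (Df / 2) Df (TwoAxis.Para.lam1 Af nL hL yT) +
      (c1f * (Af * ((shearUnit nL hL : ℤ) * (max (σT * yaLo k) (σT * yaHi k)) + shearUnit nL hL - 1))) / Df + 1 ≤ YHI k 1)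
    (hYf₁ : ∀ k ≤ N₃, sgOf du = 1 → flo ≤ YLO k du.1 ∧ YHI k du.1 ≤ fhi) (hYf₂ : ∀ k ≤ N₃, sgOf du = -1 → flo ≤ -YHI k du.1 ∧ -YLO k du.1 ≤ fhi)
    (hYf₃ : ∀ k ≤ N₃, -fw ≤ YLO k (oth du.1) ∧ YHI k (oth du.1) ≤ fw)
    (hL0 : LLO 0 ≤ TwoAxis.Para.coarse c0f (Df / 2) Df (TwoAxis.Para.lam0 Af vα vβ yT) +
      (c0f * (Af * (modulus nL hL vα vβ * (min (σT * lbLo) (σT * lbHi)) -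
        max (vα * ((shearUnit nL hL : ℤ) * (min (σT * laLo) (σT * laHi) - 1))) (vα * ((shearUnit nL hL : ℤ) * (max (σT * laLo) (σT * laHi)) + shearUnit nL hL - 1))) / nL)) / Df)
    (hL1 : TwoAxis.Para.coarse c0f (Df / 2) Df (TwoAxis.Para.lam0 Af vα vβ yT) +
      (c0f * (Af * (modulus nL hL vα vβ * (max (σT * lbLo) (σT * lbHi)) -
        min (vα * ((shearUnit nL hL : ℤ) * (min (σT * laLo) (σT * laHi) - 1))) (vα * ((shearUnit nL hL : ℤ) * (max (σT * laLo) (σT * laHi)) + shearUnit nL hL - 1))) / nL)) / Df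
        + 1 ≤ LHI 0)
    (hL2 : LLO 1 ≤ TwoAxis.Para.coarse c1f (Df / 2) Df (TwoAxis.Para.lam1 Af nL hL yT) + (c1f * (Af * ((shearUnit nL hL : ℤ) * (min (σT * laLo) (σT * laHi) - 1)))) / Df)
    (hL3 : TwoAxis.Para.coarse c1f (Df / 2) Df (TwoAxis.Para.lam1 Af nL hL yT) +
      (c1f * (Af * ((shearUnit nL hL : ℤ) * (max (σT * laLo) (σT * laHi)) + shearUnit nL hL - 1))) / Df + 1 ≤ LHI 1)
    (hxa : ∀ x ∈ Finset.Icc B.core1Lo B.core1Hi, |x 0 - σ * yL 0| ≤ qB)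
    (hxb : ∀ x ∈ Finset.Icc B.core1Lo B.core1Hi,
      |σ * ((nL : ℤ) * (x 1 - yL 1) - hL * (σ * x 0 - yL 0))| + shearUnit nL hL ≤ ((nL * ℓ' / shearUnit nL hL + 1 : ℕ) : ℤ) * shearUnit nL hL)
    (hxy : ∀ a s : ℤ, (xPrmW nL ℓ' hL R's qB Nr).aLo (Nr + 1) ≤ a → a ≤ (xPrmW nL ℓ' hL R's qB Nr).aHi (Nr + 1) →
      (xPrmW nL ℓ' hL R's qB Nr).bLo (Nr + 1) ≤ s / (shearUnit nL hL : ℤ) → s / (shearUnit nL hL : ℤ) ≤ (xPrmW nL ℓ' hL R's qB Nr).bHi (Nr + 1) →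
      (yPrmW nL ℓ' hL vL R'₃ qB₃ N₃).InCore 0 ((σT * σ * s - σT * ((nL : ℤ) * (yT - yL) 1 - hL * (yT - yL) 0)) / (shearUnit nL hL : ℤ))
        (σT * σ * a - σT * (yT - yL) 0))
    -- seed clearances: the bridge segment by the α-offset; the two bands in SERVED FORM (L-F5)
    (hclr₁ : (kb : ℤ) < B.B₀lo 0 - B.R' - B.pr)
    (hclear₂ : ∀ k ≤ Nr, ∀ w ∈ graphBall G c L, runX φ cL nL hL σ w ∈ (xRunSched nL ℓ' hL R's qB Nr).region k → w ∉ S)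
    (hclear₃ : ∀ k ≤ N₃, ∀ w ∈ graphBall G c L, runY φ cT nL hL σT w ∈ (yRunSched hnL hvL hlay R'₃ qB₃ N₃).region k → w ∉ S)
    (hπ1 : (B.core1Lo 0).natAbs + (B.core1Lo 1).natAbs ≤ L) (hπ2 : RcL + (Nr + 1) * shearUnit nL hL ≤ L)
    (hπ3 : ∀ k ≤ N₃, RcT + (((((k + 1 : ℕ) : ℤ) * vL).natAbs +
      (((shearUnit nL hL : ℤ) * |((k + 1 : ℕ) : ℤ) * (yPrmW nL ℓ' hL vL R'₃ qB₃ N₃).sLo| + |hL| * |((k + 1 : ℕ) : ℤ) * vL| + shearUnit nL hL) / nL).natAbs + 1)) ≤ L)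
    {S₀ : Finset V} (hS₀ : S₀ ⊆ S) (hSU : S ⊆ pgramPrismFin G φ c nL hL (3 * ℓ') Rl) {Δ' : ℕ} {δ ε η : ℝ} (hδ : 0 < δ)
    (hlink : 1 - δ < (bondPercolation G q).real (linkIn (↑(pgramPrismFin G φ c nL hL (3 * ℓ') Rl) : Set V) S₀ (pgSideHalfW G φ c nL hL ℓ' Rl σ 1)))
    (hchain : ∀ (W : Sym2 V → unitInterval) (s : Fin (0 + 1 + Nr + 1 + N₃ + 1) → TStep (winGraph G c L))
      (T' : Fin (0 + 1 + Nr + 1 + N₃ + 1) → Finset V) (η : ℝ),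
      (∀ i, (s i).L.o = (s 0).L.o) →
      (∀ i : Fin (0 + 1 + Nr + 1 + N₃), T' (Fin.castSucc i) ⊆ (s i.succ).L.X 0) →
      (∀ i, T' i ⊆ (s i).T) →
      (∀ i, (s i).KitsAt W q Δ' δ) →
      η ≤ δ / 2 →
      (∀ i, (prodBernoulli W).real (⋃ t ∈ (s i).T \ T' i, openConn (s 0).L.o t) ≤ η) →
      1 - δ < (prodBernoulli W).real (s 0).L.reachB →
        1 - ε < (prodBernoulli W).real (⋃ t ∈ T' (Fin.last (0 + 1 + Nr + 1 + N₃)), openConn (s 0).L.o t))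
    (hcount₁ : 1 / (1 - (q : ℝ)) ^ (Δ' * N₁) ≤ δ * ((Finset.Icc j₀₁ j₁₁).card : ℝ))
    (hcount₂ : 1 / (1 - (q : ℝ)) ^ (Δ' * N₂) ≤ δ * ((Finset.Icc j₀₂ j₁₂).card : ℝ))
    (hcount₃ : 1 / (1 - (q : ℝ)) ^ (Δ' * N₃') ≤ δ * ((Finset.Icc j₀₃ j₁₃).card : ℝ))
    (hη : η ≤ δ / 2)
    (Pb Pr : ApronPrm) {Mz Rs Kmaxb KCmaxb Kmaxr KCmaxr rsb rsr cSb cSr cU r₁ r₂ Rb : ℕ}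
    (hPNb : 1 ≤ Pb.N) (hAb : Pb.A = (Mz : ℤ) + 2)
    (hd1b : Pb.W + Pb.ℓ ≤ Pb.d) (hD1b : Pb.W + Pb.ℓ + Pb.d + 2 ≤ shellD Pb) (hD2b : Pb.ℓ + Rs + Pb.d + 3 ≤ shellD Pb) (hDρb : Rs + 1 ≤ shellD Pb)
    (hℓb : 1 ≤ Pb.ℓ) (hWb : Rs + Pb.ℓ ≤ Pb.W) (hKmaxb : shellD Pb + Pb.W ≤ Kmaxb) (hKCmaxb : shellD Pb + Mz + 1 ≤ KCmaxb)
    (hR'b : cylRadMax G φ types Pb.ℓ (Rs + KCmaxb + (Pb.W + Kmaxb)) ≤ Pb.R')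
    (hwideb : ∀ j ≤ j₁₁, ∀ i, (B.B₀lo - (j : Site 2)) i + 2 * tanOff Pb.ℓs Pb.M ≤ (B.B₀hi + (j : Site 2)) i)
    (hdwb : ∀ j ≤ j₁₁, ∀ i, (B.B₀lo - (j : Site 2)) i + (Pb.d + 2 : ℕ) ≤ (B.B₀hi + (j : Site 2)) i)
    (hDwb : ∀ j ≤ j₁₁, ∀ i, (B.B₀lo - (j : Site 2)) i + ((shellD Pb + 1 + Pb.d + KCmaxb + Rs : ℕ) : ℤ) ≤ (B.B₀hi + (j : Site 2)) i)
    (hTb : (Pb.W : ℤ) + Kmaxb + Pb.ℓ + 1 ≤ tanOff Pb.ℓs Pb.M) (hT'b : (shellD Pb : ℤ) + KCmaxb + Rs ≤ tanOff Pb.ℓs Pb.M)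
    (hr₀b : Pb.N * (tanOff Pb.ℓs Pb.M + 2) + Pb.N * Pb.d + (Pb.W + Kmaxb + Pb.R') + (KCmaxb + Rs) ≤ Pb.r₀) (hRb₀ : Pb.r₀ ≤ L)
    (hrsb : 2 * (1 + Pb.N * (tanOff Pb.ℓs Pb.M + 2) + Pb.N * Pb.d + (Pb.W + Kmaxb + Pb.R') + (KCmaxb + Rs)) ≤ rsb)
    (hcSb : (Pb.N + 1) * (tanOff Pb.ℓs Pb.M + 1) + (Pb.N + 1) * Pb.d + (2 * Pb.W + 1) * (Kmaxb + 1) * (Δg + 1) ^ Pb.R' ≤ cSb)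
    (hEb : j₁₁ + (Pb.N * (tanOff Pb.ℓs Pb.M + 1) + Pb.N * Pb.d + KCmaxb) ≤ B.R')
    (hreachb : r₁ + (Pb.N * (tanOff Pb.ℓs Pb.M + 1) + Pb.N * Pb.d + KCmaxb) ≤ Pb.r₀) (hr₁ : Rb ≤ r₁) (hr₁R : r₁ ≤ L)
    (hPNr : kq + 3 ≤ Pr.N) (hAr : Pr.A = (Mz + 1 : ℕ) * (shearUnit nL hL : ℤ) + 1)
    (hd1r : Pr.W + Pr.ℓ ≤ Pr.d) (hD1r : Pr.W + Pr.ℓ + Pr.d + 2 ≤ shellD Pr) (hD2r : Pr.ℓ + Rs + Pr.d + 3 ≤ shellD Pr) (hDρr : Rs + 1 ≤ shellD Pr)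
    (hℓr : 1 ≤ Pr.ℓ) (hWr : Rs + Pr.ℓ ≤ Pr.W) (hKmaxr : (shellD Pr + Pr.W) * (kq + 1) ≤ Kmaxr) (hKCmaxr : (shellD Pr + Mz + 1) * (kq + 1) ≤ KCmaxr)
    (hR'r : cylRadMax G φ types Pr.ℓ (Rs + KCmaxr + (Pr.W + Kmaxr)) ≤ Pr.R')
    (hwider : ∀ k ≤ Nr, ∀ j ≤ j₁₂, ∀ i, ((xRunSched nL ℓ' hL R's qB Nr).lo k - (j : Site 2)) i + 2 * tanOff Pr.ℓs Pr.M ≤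
      ((xRunSched nL ℓ' hL R's qB Nr).hi k + (j : Site 2)) i)
    (hdwr : ∀ k ≤ Nr, ∀ j ≤ j₁₂, ∀ i, ((xRunSched nL ℓ' hL R's qB Nr).lo k - (j : Site 2)) i + (Pr.d + 2 : ℕ) ≤
      ((xRunSched nL ℓ' hL R's qB Nr).hi k + (j : Site 2)) i)
    (hDwr : ∀ k ≤ Nr, ∀ j ≤ j₁₂, ∀ i, ((xRunSched nL ℓ' hL R's qB Nr).lo k - (j : Site 2)) i + ((shellD Pr + 1 + Pr.d + KCmaxr + Rs : ℕ) : ℤ) ≤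
      ((xRunSched nL ℓ' hL R's qB Nr).hi k + (j : Site 2)) i)
    (hwidey : ∀ k ≤ N₃, ∀ j ≤ j₁₃, ∀ i, ((yRunSched hnL hvL hlay R'₃ qB₃ N₃).lo k - (j : Site 2)) i + 2 * tanOff Pr.ℓs Pr.M ≤
      ((yRunSched hnL hvL hlay R'₃ qB₃ N₃).hi k + (j : Site 2)) i)
    (hdwy : ∀ k ≤ N₃, ∀ j ≤ j₁₃, ∀ i, ((yRunSched hnL hvL hlay R'₃ qB₃ N₃).lo k - (j : Site 2)) i + (Pr.d + 2 : ℕ) ≤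
      ((yRunSched hnL hvL hlay R'₃ qB₃ N₃).hi k + (j : Site 2)) i)
    (hDwy : ∀ k ≤ N₃, ∀ j ≤ j₁₃, ∀ i, ((yRunSched hnL hvL hlay R'₃ qB₃ N₃).lo k - (j : Site 2)) i + ((shellD Pr + 1 + Pr.d + KCmaxr + Rs : ℕ) : ℤ) ≤
      ((yRunSched hnL hvL hlay R'₃ qB₃ N₃).hi k + (j : Site 2)) i)
    (hTr : (Pr.W : ℤ) + Kmaxr + Pr.ℓ + 1 ≤ tanOff Pr.ℓs Pr.M) (hT'r : (shellD Pr : ℤ) + KCmaxr + Rs ≤ tanOff Pr.ℓs Pr.M)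
    (hr₀r : Pr.N * (tanOff Pr.ℓs Pr.M + 2) + Pr.N * Pr.d + (Pr.W + Kmaxr + Pr.R') + (KCmaxr + Rs) ≤ Pr.r₀) (hRr₀ : Pr.r₀ ≤ L)
    (hrsr : 2 * (1 + Pr.N * (tanOff Pr.ℓs Pr.M + 2) + Pr.N * Pr.d + (Pr.W + Kmaxr + Pr.R') + (KCmaxr + Rs)) ≤ rsr)
    (hcSr : (Pr.N + 1) * (tanOff Pr.ℓs Pr.M + 1) + (Pr.N + 1) * Pr.d + (2 * Pr.W + 1) * (Kmaxr + 1) * (Δg + 1) ^ Pr.R' ≤ cSr)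
    (hEr : j₁₂ + (Pr.N * (tanOff Pr.ℓs Pr.M + 1) + Pr.N * Pr.d + KCmaxr) ≤ R's)
    (hEy : j₁₃ + (Pr.N * (tanOff Pr.ℓs Pr.M + 1) + Pr.N * Pr.d + KCmaxr) ≤ R'₃)
    (hreachr : r₂ + (Pr.N * (tanOff Pr.ℓs Pr.M + 1) + Pr.N * Pr.d + KCmaxr) ≤ Pr.r₀) (hr₂ : Rl ≤ r₂) (hr₂R : r₂ ≤ L)
    (QK : ShortPcO V) (hRgRs : ∀ c', QK.RS c' ≤ Rs) (hRgcard : ∀ c', (RgO G φ QK c').card ≤ cU) (hcU1 : 1 ≤ cU)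
    (hnSK : ∀ c', 22 * Mz + 58 ≤ QK.nS c') (hκSK : ∀ c', |QK.hS c'| ≤ 10 * (QK.nS c' : ℤ)) (hℓSK : ∀ c', 24 * Mz + 64 ≤ QK.ℓS c')
    (hκL10 : |hL| ≤ 10 * (nL : ℤ))
    (Λc : V → ℕ → Finset V) (kz : ℕ) (hkn : ∀ c', Λc c' kz ⊆ Λc c' Mz) (hΛ : ∀ c', ∀ v ∈ Λc c' Mz, v ∈ RgO G φ QK c' ∧ φ v - φ c' ∈ box 2 Mz)
    (hZ : ∀ c', (↑(Λc c' Mz) : Set V) ⊆ cyl φ c' Mz) (hMz : Mz < nL) (hclrz : (Mz + 4) * (nL + hL.natAbs) ≤ nL * (ℓ' + 1))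
    (Qb Fb : V → Finset V)
    (hQb : ∀ c', ∀ w ∈ Qb c', w ∈ graphBall G c' Rb ∧
      rootFrame φ c σ w ∈ Finset.Icc (rootFrame φ c σ c' - ((B.pr : ℕ) : Site 2)) (rootFrame φ c σ c' + ((B.pr : ℕ) : Site 2)))
    (hFb : ∀ c', ∀ w ∈ Fb c', w ∈ Qb c' ∧ rootFrame φ c σ w ∈ Finset.Icc (rootFrame φ c σ c' + B.dlo) (rootFrame φ c σ c' + B.dhi))
    (hFZ : ∀ c', Disjoint (Fb c') (Λc c' Mz))
    (kk₁ kk₂ kk₃ : ℕ) (hkN₁ : kk₁ * (Δg + 1) ^ (2 * rsb) ≤ N₁) (hkN₂ : kk₂ * (Δg + 1) ^ (2 * rsr) ≤ N₂) (hkN₃ : kk₃ * (Δg + 1) ^ (2 * rsr) ≤ N₃')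
    (hk₁ : (1 - (q : ℝ) ^ (1 + Δg * cSb + cSb * cU)) ^ kk₁ ≤ δ) (hk₂ : (1 - (q : ℝ) ^ (1 + Δg * cSr + cSr * cU)) ^ kk₂ ≤ δ)
    (hk₃ : (1 - (q : ℝ) ^ (1 + Δg * cSr + cSr * cU)) ^ kk₃ ≤ δ)
    (hzone : ∀ c', 1 - δ ^ 2 < (bondPercolation G q).real (UniqZone.zone G (Λc c') kz Mz))
    (hexitb : ∀ c' (i : Fin 2) (σ₀ : ℤˣ), 1 - δ ^ 2 < (bondPercolation G q).real
      (linkIn (↑(RgO G φ QK c') : Set V) (Λc c' kz) (pexRO G φ QK Mz Pb.A σ i σ₀ c')))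
    (hexitr : ∀ c' (i : Fin 2) (σ₀ : ℤˣ), 1 - δ ^ 2 < (bondPercolation G q).real
      (linkIn (↑(RgO G φ QK c') : Set V) (Λc c' kz) (pexXO G φ QK Mz nL hL Pr.A σ i σ₀ c')))
    (hexity : ∀ c' (i : Fin 2) (σ₀ : ℤˣ), 1 - δ ^ 2 < (bondPercolation G q).real
      (linkIn (↑(RgO G φ QK c') : Set V) (Λc c' kz) (pexYO G φ QK Mz nL hL Pr.A σT i σ₀ c')))
    (hbridge : ∀ c', 1 - δ ^ 2 < (bondPercolation G q).real (linkIn (↑(Qb c') : Set V) (Λc c' kz) (Fb c')))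
    (hlongx : ∀ c' (τ : ℤ), τ = 1 ∨ τ = -1 → 1 - δ ^ 2 < (bondPercolation G q).real
      (linkIn (pgramPrism G φ c' nL hL (3 * ℓ') Rl) (Λc c' kz) (pgSideHalfW G φ c' nL hL ℓ' Rl σ (σ * τ))))
    (hlongy : ∀ c' (τ : ℤ), τ = 1 ∨ τ = -1 → 1 - δ ^ 2 < (bondPercolation G q).real
      (linkIn (pgramPrism G φ c' nL hL (3 * ℓ') Rl) (Λc c' kz) (pgTopPieceW G φ c' nL hL ℓ' Rl σT τ vL)))
    {R₁ : ℕ}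
    (hR₁ : ∀ (c' : V) (R' : ℕ), R₁ ≤ R' → ∀ (Rw : ℕ) (D' B' : Finset V), (∀ d ∈ D', d ∈ graphBall G c' Rw) →
      (∀ d ∈ D', ∀ d' ∈ D', φ d - φ d' ∈ box 2 (2 * L)) → B' ⊆ D' → (∀ a ∈ B', a ∈ graphBall G c' ρ) →
        (bondPercolation G q).real (excess G c' R' D' B') ≤ η)
    (hR₁b : R₁ ≤ L - Pb.r₀) (hR₁r : R₁ ≤ L - Pr.r₀) :
    ∃ Qt Ft : Finset V, Ft ⊆ T ∧ Qt ⊆ D ∧ Disjoint Ft Z ∧ 1 - ε < (prodBernoulli Wt).real (linkIn (↑Qt : Set V) S Ft) := by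
  set FS := fineSkel φ c Af nL hL vα vβ c0f c1f (Df / 2) (Df / 2) Df with hFS
  set SN := xRunSched nL ℓ' hL R's qB Nr with hSN
  set SY := yRunSched hnL hvL hlay R'₃ qB₃ N₃ with hSY
  have hU0 : 0 < (shearUnit nL hL : ℤ) := shearUnit_pos hnL hL
  have hσabs : |σ| = 1 := by rcases hσ with h | h <;> simp [h]
  have hσsq : σ * σ = 1 := by rcases hσ with rfl | rfl <;> simp
  obtain ⟨he0, he1⟩ := fineSkel_of_φ_eq (φ := φ) c (Af := Af) (nL := nL) (hL := hL) (vα := vα) (vβ := vβ) (c0f := c0f) (c1f := c1f) (Df := Df) hcLφ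
  obtain ⟨hf0, hf1⟩ := fineSkel_of_φ_eq (φ := φ) c (Af := Af) (nL := nL) (hL := hL) (vα := vα) (vβ := vβ) (c0f := c0f) (c1f := c1f) (Df := Df) hcTφ
  -- the inner ball inside the outer ball
  have hball : ∀ {w : V}, w ∈ graphBall G c L → w ∈ graphBall G w₀ Rπ := by
    intro w hw
    have h2 := BoxProdZ2.mem_graphBall_add G hcL hw
    rwa [Nat.sub_add_cancel hLπ] at h2
  -- run coordinates at `cL` versus bridge-frame coordinates
  have hrun0 : ∀ w, runX φ cL nL hL σ w 0 = rootFrame φ c σ w 0 - σ * yL 0 := fun w => by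
    rw [runX_zero, relCoord_apply, rootFrame_apply_zero, hcLφ, Pi.add_apply]; ring
  have hrun1 : ∀ w, runX φ cL nL hL σ w 1 = (σ * ((nL : ℤ) * (rootFrame φ c σ w 1 - yL 1) - hL * (σ * rootFrame φ c σ w 0 - yL 0))) / (shearUnit nL hL : ℤ) :=
    fun w => by
    rw [runX_one, shearCoord_apply, rootFrame_apply_zero, rootFrame_apply_one, hcLφ, Pi.add_apply, Pi.add_apply]
    congr 1
    have : σ * (σ * (φ w 0 - φ c 0)) = φ w 0 - φ c 0 := by rw [← mul_assoc, hσsq, one_mul]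
    rw [this]; ring
  -- (1) near-`c` footprints by the two lattice functionals (L-F2): the bridge region and the hop prism
  have hσσ : ∀ z : ℤ, σ * (σ * z) = z := fun z => by rw [← mul_assoc, hσsq, one_mul]
  have hfoot₁ : ∀ w ∈ graphBall G c L, rootFrame φ c σ w ∈ Finset.Icc B.regionLo B.regionHi → ψc w ∈ Pl := fun w hw hw' => by
    obtain ⟨h0, h1⟩ := hΛR _ hw'
    simp only [rootFrame_apply_zero, rootFrame_apply_one, hσσ] at h0 h1
    exact hPlfoot w hw (hnear w h0 h1)
  have hQL : ∀ w ∈ pgramPrismFin G φ c nL hL (3 * ℓ') Rl, w ∈ graphBall G c L := fun w hw =>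
    graphBall_mono G c hRlL (pgramPrism_subset_graphBall c nL hL (3 * ℓ') Rl ((mem_pgramPrismFin G φ).1 hw))
  have hQfoot : ∀ w ∈ pgramPrismFin G φ c nL hL (3 * ℓ') Rl, ψc w ∈ Pl := fun w hw => by
    obtain ⟨h0, h1⟩ := lam_bounds_of_mem_pgramCyl (φ := φ) hnL hvα hmf ((mem_pgramPrism G φ).1 ((mem_pgramPrismFin G φ).1 hw)).2
    exact hPlfoot w (hQL w hw) (hnear w (h0.trans hΛQ0) (h1.trans hΛQ1))
  have hUD : pgramPrismFin G φ c nL hL (3 * ℓ') Rl ⊆ D := fun w hw =>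
    hPlD ((mem_Win G ψc).2 ⟨hball (hQL w hw), hQfoot w hw⟩)
  -- (2) the hop's landing inside core `0` of the bridge
  have hT₀ : ∀ w ∈ pgSideHalfW G φ c nL hL ℓ' Rl σ 1, w ∈ graphBall G c L ∧ rootFrame φ c σ w ∈ Finset.Icc B.B₀lo B.B₀hi := fun w hw => by
    refine ⟨hQL w ((mem_pgramPrismFin G φ).2 (coe_pgSideHalfW_subset (G := G) (φ := φ) c nL hL ℓ' Rl σ 1 (Finset.mem_coe.2 hw))), hB0 ?_⟩
    have hb := rootFrame_mem_box_of_sideHalf_same c hσ hnL (h := hL) (ℓ := ℓ') (R := Rl) (τ := 1) (Or.inl rfl) hw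
    rw [rootFrame_self, zero_add, zero_add, one_mul, min_eq_left (by positivity : (0 : ℤ) ≤ ℓ'), max_eq_right (by positivity : (0 : ℤ) ≤ ℓ'), add_zero] at hb
    exact hb
  -- (3) the x-run's regions
  have hreadP : ∀ k ≤ Nr, ∀ w, runX φ cL nL hL σ w ∈ SN.region k → FootBox flo fhi fw du (FS w) := fun k hk w hw => by
    have hw' := runX_sign_mem_Icc cL hnL hL hσ (hreg k hk hw)
    refine footBox_of_runX_mem_Icc c hAf hnL hmf hc0 hc1 hDf cL (LO := PLO k) (HI := PHI k) ?_ ?_ ?_ ?_ (hPf₁ k hk) (hPf₂ k hk) (hPf₃ k hk) hw'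
    · rw [he0]; simpa only [pt_zero, pt_one] using hP0 k hk
    · rw [he0]; simpa only [pt_zero, pt_one] using hP1 k hk
    · rw [he1]; simpa only [pt_zero, pt_one] using hP2 k hk
    · rw [he1]; simpa only [pt_zero, pt_one] using hP3 k hk
  have hfoot₂ : ∀ k ≤ Nr, ∀ w ∈ graphBall G c L, runX φ cL nL hL σ w ∈ SN.region k → ψc w ∈ Pl :=
    fun k hk w hw hw' => hPlfoot w hw (hreadP k hk w hw')
  -- (3′) the y′-run's regions and last core
  have hreadY : ∀ k ≤ N₃, ∀ w, runY φ cT nL hL σT w ∈ SY.region k → FootBox flo fhi fw du (FS w) := fun k hk w hw => by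
    have hw' := runY_sign_mem_Icc cT hnL hL hσT (hregY k hk hw)
    refine footBox_of_runX_mem_Icc c hAf hnL hmf hc0 hc1 hDf cT (LO := YLO k) (HI := YHI k) ?_ ?_ ?_ ?_ (hYf₁ k hk) (hYf₂ k hk) (hYf₃ k hk) hw'
    · rw [hf0]; simpa only [pt_zero, pt_one] using hY0 k hk
    · rw [hf0]; simpa only [pt_zero, pt_one] using hY1 k hk
    · rw [hf1]; simpa only [pt_zero, pt_one] using hY2 k hk
    · rw [hf1]; simpa only [pt_zero, pt_one] using hY3 k hk
  have hfoot₃ : ∀ k ≤ N₃, ∀ w ∈ graphBall G c L, runY φ cT nL hL σT w ∈ SY.region k → ψc w ∈ Pl :=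
    fun k hk w hw hw' => hPlfoot w hw (hreadY k hk w hw')
  have hlastf : ∀ w ∈ graphBall G c L, runY φ cT nL hL σT w ∈ SY.core (N₃ + 1) → w ∈ MM := fun w hw hw' => by
    have hw'' := runY_sign_mem_Icc cT hnL hL hσT (hlastc hw')
    refine hMfoot w hw (fine_mem_Icc_of_runX_mem_Icc_signed c hAf hnL hmf hc0 hc1 hDf cT (LO := LLO) (HI := LHI) ?_ ?_ ?_ ?_ hw'')
    · rw [hf0]; simpa only [pt_zero, pt_one] using hL0
    · rw [hf0]; simpa only [pt_zero, pt_one] using hL1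
    · rw [hf1]; simpa only [pt_zero, pt_one] using hL2
    · rw [hf1]; simpa only [pt_zero, pt_one] using hL3
  -- (4) clearances
  have hSk : ∀ a ∈ S, |rootFrame φ c σ a 0| ≤ kb := fun a ha => by
    rw [rootFrame_apply_zero, abs_mul, hσabs, one_mul]; exact hSφ a ha
  -- (5) the cross links
  have hx₁₂ : ∀ w ∈ graphBall G c L, rootFrame φ c σ w ∈ Finset.Icc B.core1Lo B.core1Hi → runX φ cL nL hL σ w ∈ SN.core 0 := by
    intro w _ hw
    rw [hSN, xRunSched, mem_scheduleN_core_iff (xPrmW_ok nL ℓ' hL R's qB Nr) (xPrmW_eb nL ℓ' hL R's qB Nr), RunPrm.inCore_zero_iff, hrun0, hrun1]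
    have ha := abs_le.1 (hxa _ hw)
    have hb := hxb _ hw
    set sv := σ * ((nL : ℤ) * (rootFrame φ c σ w 1 - yL 1) - hL * (σ * rootFrame φ c σ w 0 - yL 0)) with hsv
    have hW : (((nL * ℓ' / shearUnit nL hL + 1 : ℕ) : ℤ)) = ((xPrmW nL ℓ' hL R's qB Nr).Wm : ℤ) := by simp [xPrmW]
    have hW' : (((nL * ℓ' / shearUnit nL hL + 1 : ℕ) : ℤ)) = ((xPrmW nL ℓ' hL R's qB Nr).Wp : ℤ) := by simp [xPrmW]
    have hq : ((xPrmW nL ℓ' hL R's qB Nr).q : ℤ) = qB := by simp [xPrmW]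
    rw [hq, ← hW, ← hW']
    have hsv' := abs_le.1 (show |sv| ≤ ((nL * ℓ' / shearUnit nL hL + 1 : ℕ) : ℤ) * shearUnit nL hL - shearUnit nL hL by linarith)
    refine ⟨ha.1, ha.2, ?_, ?_⟩
    · rw [Int.le_ediv_iff_mul_le hU0]
      linarith only [hsv'.1]
    · have hlt : sv / (shearUnit nL hL : ℤ) < ((nL * ℓ' / shearUnit nL hL + 1 : ℕ) : ℤ) + 1 := by
        rw [Int.ediv_lt_iff_lt_mul hU0]
        have e : (((nL * ℓ' / shearUnit nL hL + 1 : ℕ) : ℤ) + 1) * (shearUnit nL hL : ℤ) =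
            ((nL * ℓ' / shearUnit nL hL + 1 : ℕ) : ℤ) * shearUnit nL hL + shearUnit nL hL := by ring
        rw [e]; linarith only [hsv'.2, hU0]
      exact Int.lt_add_one_iff.1 hlt
  have hcT' : φ cT = φ cL + (yT - yL) := by rw [hcTφ, hcLφ, add_assoc, add_sub_cancel]
  have hx₂₃ : ∀ w ∈ graphBall G c L, runX φ cL nL hL σ w ∈ SN.core (Nr + 1) → runY φ cT nL hL σT w ∈ SY.core 0 :=
    fun w _ hw => runY_core_zero_of_runX_core hnL hσ hvL hlay R'₃ qB₃ N₃ hcT' hxy hw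
  -- (6) nonempty targets
  have hTne₁ : (Win G (rootFrame φ c σ) c (Finset.Icc B.core1Lo B.core1Hi) L).Nonempty := by
    obtain ⟨g, hg, hφg⟩ := exists_mem_graphBall_φ_eq hstep c (φ c + pt (σ * B.core1Lo 0) (B.core1Lo 1))
    refine ⟨g, (mem_Win G _).2 ⟨graphBall_mono G c ?_ hg, ?_⟩⟩
    · simp only [Pi.add_apply, pt_zero, pt_one, add_sub_cancel_left]
      rw [Int.natAbs_mul, show σ.natAbs = 1 by rcases hσ with h | h <;> simp [h], one_mul]
      exact hπ1
    · have h0 : rootFrame φ c σ g 0 = B.core1Lo 0 := by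
        rw [rootFrame_apply_zero, hφg, Pi.add_apply, pt_zero]; rw [show φ c 0 + σ * B.core1Lo 0 - φ c 0 = σ * B.core1Lo 0 by ring, ← mul_assoc, hσsq, one_mul]
      have h1 : rootFrame φ c σ g 1 = B.core1Lo 1 := by
        rw [rootFrame_apply_one, hφg, Pi.add_apply, pt_one]; ring
      have hg' : rootFrame φ c σ g = B.core1Lo := by funext i; fin_cases i <;> assumption
      rw [hg']
      exact Finset.mem_Icc.2 ⟨le_rfl, BridgePrm.core1Lo_le_core1Hi hB⟩
  have hTne₂ : ∀ k ≤ Nr, (Win G (runX φ cL nL hL σ) c (SN.core (k + 1)) L).Nonempty := by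
    intro k hk
    obtain ⟨g, hg, hφg⟩ := exists_mem_graphBall_φ_eq hstep cL (φ cL + pt (σ * (((k + 1 : ℕ) : ℤ) * nL)) (σ * (((k + 1 : ℕ) : ℤ) * hL)))
    refine ⟨g, (mem_Win G _).2 ⟨?_, ?_⟩⟩
    · have hg' : g ∈ graphBall G cL ((k + 1) * shearUnit nL hL) := by
        refine graphBall_mono G cL (le_of_eq ?_) hg
        simp only [Pi.add_apply, pt_zero, pt_one, add_sub_cancel_left, Int.natAbs_mul, show σ.natAbs = 1 by rcases hσ with h | h <;> simp [h], one_mul,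
          Int.natAbs_natCast]
        unfold shearUnit; ring
      have h := BoxProdZ2.mem_graphBall_add G hcLπ hg'
      refine graphBall_mono G c ?_ h
      have : (k + 1) * shearUnit nL hL ≤ (Nr + 1) * shearUnit nL hL := Nat.mul_le_mul_right _ (by omega)
      omega
    · rw [hSN, xRunSched, mem_scheduleN_core_iff (xPrmW_ok nL ℓ' hL R's qB Nr) (xPrmW_eb nL ℓ' hL R's qB Nr)]
      have h0 : runX φ cL nL hL σ g 0 = ((k + 1 : ℕ) : ℤ) * nL := by
        rw [runX_zero, relCoord_apply, hφg, Pi.add_apply, pt_zero]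
        rw [show φ cL 0 + σ * (((k + 1 : ℕ) : ℤ) * ↑nL) - φ cL 0 = σ * (((k + 1 : ℕ) : ℤ) * ↑nL) by ring, ← mul_assoc, hσsq, one_mul]
      have h1 : runX φ cL nL hL σ g 1 = 0 := by
        rw [runX_one, shearCoord_apply, hφg, Pi.add_apply, Pi.add_apply, pt_zero, pt_one]
        rw [show σ * (↑nL * (φ cL 1 + σ * (((k + 1 : ℕ) : ℤ) * hL) - φ cL 1) - hL * (φ cL 0 + σ * (((k + 1 : ℕ) : ℤ) * ↑nL) - φ cL 0)) = 0 by ring]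
        simp
      rw [h0, h1]
      have hnom := RunPrm.inCore_nominal (xPrmW_ok nL ℓ' hL R's qB Nr) (k + 1)
      have hs : ((xPrmW nL ℓ' hL R's qB Nr).sLo : ℤ) = nL := rfl
      have hd : ((xPrmW nL ℓ' hL R's qB Nr).d : ℤ) = 0 := rfl
      rw [hs, hd, mul_zero] at hnom
      exact hnom
  have hTne₃ : ∀ k ≤ N₃, (Win G (runY φ cT nL hL σT) c (SY.core (k + 1)) L).Nonempty := by
    intro k hk
    obtain ⟨g, hg, hφg⟩ := exists_mem_graphBall_runY_eq hstep hnL cT hL hσT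
      (pt (((k + 1 : ℕ) : ℤ) * (yPrmW nL ℓ' hL vL R'₃ qB₃ N₃).sLo) (((k + 1 : ℕ) : ℤ) * vL))
    refine ⟨g, (mem_Win G _).2 ⟨?_, ?_⟩⟩
    · have h := BoxProdZ2.mem_graphBall_add G hcTπ hg
      refine graphBall_mono G c ?_ h
      have := hπ3 k hk
      simpa only [pt_zero, pt_one] using this
    · rw [hSY, yRunSched, mem_scheduleN_core_iff (yPrmW_ok hnL hvL hlay R'₃ qB₃ N₃) (yPrmW_eb nL ℓ' hL vL R'₃ qB₃ N₃), hφg, pt_zero, pt_one]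
      have hnom := RunPrm.inCore_nominal (yPrmW_ok hnL hvL hlay R'₃ qB₃ N₃) (k + 1)
      have hd : ((yPrmW nL ℓ' hL vL R'₃ qB₃ N₃).d : ℤ) = vL := rfl
      rw [hd] at hnom
      simpa only [Nat.cast_add, Nat.cast_one] using hnom
  -- assemble
  exact faceRoute_of_inputs3_x hlipφ hstep hfr hκ hΔg hWG hWD hDπ hcL hLπ hPlD hMT hMZ hcS hSconn hSD hSρ hρL hσ hSk B hB hnL cL cT hL hκL
    ℓ' R's qB Nr Rl hσT hvL hlay R'₃ qB₃ N₃ Rlev₁ N₁ j₀₁ j₁₁ Rlev₂ N₂ j₀₂ j₁₂ Rlev₃ N₃' j₀₃ j₁₃ hRl₁ hRl₂ hRl₃ hj₁ hj₂ hj₃ hfoot₁ hfoot₂ hfoot₃ hclr₁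
    hclear₂ hclear₃ hTne₁ hTne₂ hTne₃ hx₁₂ hx₂₃ hlastf hUD hQL hS₀ hSU hT₀ hδ hlink hchain hcount₁ hcount₂ hcount₃ hη Pb Pr hPNb hAb hd1b hD1b hD2b
    hDρb hℓb hWb hKmaxb hKCmaxb hR'b hwideb hdwb hDwb hTb hT'b hr₀b hRb₀ hrsb hcSb hEb hreachb hr₁ hr₁R hPNr hAr hd1r hD1r hD2r hDρr hℓr hWr hKmaxr
    hKCmaxr hR'r hwider hdwr hDwr hwidey hdwy hDwy hTr hT'r hr₀r hRr₀ hrsr hcSr hEr hEy hreachr hr₂ hr₂R QK hRgRs hRgcard hcU1 hnSK hκSK hℓSK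
    hκL10 Λc kz hkn hΛ hZ hMz hclrz Qb Fb hQb hFb hFZ kk₁ kk₂ kk₃ hkN₁ hkN₂ hkN₃ hk₁ hk₂ hk₃ hzone hexitb hexitr hexity hbridge hlongx
    hlongy hR₁ hR₁b hR₁r

end Skelφ

end Summit.CriticalPhenomena.PercolationContinuityZ3.Theorems.Transplant

end
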